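import Literature.NumberTheory.Automorphic.Liu2021.LemD1AsPrintedIndexedNonVacuityWildCarrier
import HarnessLib

/-!
# [Liu2021, App. D Lemma D.1 (1) ∧ (3)] AS PRINTED with the `ε`-conjunct ALONE separating — the NON-SPLIT places carrying a
# centre-trivial carrier character; and the split half: the `ε`-conjunct is identically true at split places

Reproduction ∕ bookkeeping (Literature, THEOREMS ONLY: no definition, no record, no named fact, no `sorry`; nothing is
asserted about Liu's oscillator representations or about the tree's constructed local Weil carriers).

Sequel of `…DetCarrier.lean` ∕ `…TorsionCarrier.lean` ∕ `…WildCarrier.lean` (the `μ`-conjunct of [Lem. D.1 (3)] failing ALONE) and of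
`…LevelCarrier.lean` (the `χ`-conjunct failing alone, `N` odd).  Of the three printed conjuncts «`μ' = μ`, `ε' = ε` (in `E^{−×}/Nm E^×`),
`χ' = χ`» the remaining one is `ε`: THIS FILE builds, at the rows' slot types, the joint (1) ∧ (3) model in which EXACTLY the `ε`-conjunct
fails — two members with the SAME `μ`, the SAME `χ = 1`, INEQUIVALENT representatives `e ≁ e'`, and NON-isomorphic carriers with EQUAL central
characters.  Two inputs, both in the tree: (a) at a NON-SPLIT place there are two `ε`-classes (`…NonsplitPlace.exists_epsRep_not_sameClass_of_nonsplit`,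
the local norm index `2` [Omeara1963, 63:13a]); (b) a character `Ψ` of `U(V)(F_v)` trivial on the centre, non-trivial, with an open kernel
neighbourhood — the wild carrier (`…WildCarrier`, `v_w(N) < 1`, ANY `E/F`) or the torsion carrier (`…TorsionCarrier`, `v_w(ζ − 1) = 1` for a
norm-one `ζ`, `ζ^N = 1`).  At a SPLIT place no such model exists for the `ε`-slot: there all representatives are equivalent
(`…NonsplitPlace.sameClass_of_split`), recorded here on collections as `forall_sameClass_of_split`.

* §1 line-carrier bookkeeping (private copies of the siblings' lemmas).
* §2 **`exists_lemD1IndexedFamily_item1_and_lemD1_3_eps_of_wild`** (non-split `w ∣ v`, `v_w(N) < 1`, ANY `E/F`, every `N ≥ 3`, every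
  `μ ∈ MuSet S`, every representative `e`): labels `(μ, e, 1)`, `(μ, e', 1)` with `e' ≁ e`, carriers the trivial line and the line of `Ψ`;
  (1) member by member ∧ (3) for all four pairs; `Lf.mu 0 = Lf.mu 1`, `Lf.chi 0 = Lf.chi 1`, `¬ SameClass (Lf.eps 0) (Lf.eps 1)`, the `ω`'s
  non-isomorphic.  **`exists_lemD1IndexedFamily_item1_and_lemD1_3_eps_of_torsion`** (non-split `w`, `v_w(ζ − 1) = 1`).  Hypothesis-free in `μ`
  (`…NormClassExtensionDyadic.nonempty_muSet`): **`not_forall_sameClass_of_mu_eq_of_chi_eq_of_wild`** ∕ **`…_of_torsion`** — the records do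
  NOT force «same `μ` ∧ same `χ` ⟹ same `ε`-class».  **`forall_sameClass_of_split`**: at a split place EVERY collection over the place model has
  all its representatives in one class.
* §3 the CM rows (member `0` AND member `1` carry the rows' own `μ_v = localMu L (toHeckeCharacter L ψ) v`):
  `exists_lemD1IndexedFamily_item1_and_lemD1_3_localMu_eps_of_wild`, `not_forall_sameClass_of_mu_eq_of_chi_eq_of_isCMField_of_wild` (ANY CM
  field, non-split `w` with `v_w(N) < 1` — for `3 ∣ N`: above `3`), `…_of_cubeRoot` (`L ∋ ζ_3`, `3 ∣ N`, non-split `w ∤ 3`), and the synthesis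
  **`forall_not_forall_sameClass_of_mu_eq_of_chi_eq_of_isCMField_of_cubeRoot`**: for `L ∋ ζ_3`, `3 ∣ N`, at EVERY non-split `w ∣ v` over EVERY
  finite place `v` of `L⁺`.

With `…LevelCarrier` (χ alone, `N` odd), `…DetCarrier` ∕ `…TorsionCarrier` ∕ `…WildCarrier` (μ alone) this completes, for the END's rank `N = 3` and a
CM field `L ∋ ζ_3`, the picture «each of the three conjuncts of [Lem. D.1 (3)] AS PRINTED can fail ALONE in a joint (1) ∧ (3) model at the rows'
slot types» at every place where the slot in question is not identically trivial (`ε`: the non-split places).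

What this does NOT give: an `ε`-alone model at a non-split place carrying NO centre-trivial character of the kind above (`v_w(N) = 1`, no
norm-one torsion off `w`); anything about the rows' OWN carriers `𝓢.omegaLoc v`; Lem. D.1 itself.  HC_CM is NOT proved.

Cell pub-hodgecm2 (COR-CM), audit class of the END rows `hD1''` ∕ `hD3`; seat prover-pub-hodgecm2-b10.

References: [Liu2021] Y. Liu, *Fourier–Jacobi cycles and arithmetic relative trace formula*, Camb. J. Math. 9 (2021) =
arXiv:2102.11518, App. D §D.1 Step 1 (l. 5217), Steps 2–3 (l. 5219–5221), Lemma D.1 (1) (l. 5229), (3) (l. 5233), Def. 4.11 (l. 2086);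
[Omeara1963] O. T. O'Meara, *Introduction to Quadratic Forms* (1963), §63B Cor. 63:13a (the local norm index `2`); [NeukirchANT1999]
Ch. II §3 Prop. (3.10), Ch. V §1 Thm. (1.3); [CasselsFrohlichANT1967] Ch. II §10, Ch. VII §1.1; [Mok2014] §1 Notation p. 5.
-/

noncomputable section

open scoped Matrix MatrixGroups
open NumberField IsDedekindDomain
open Literature.RepresentationTheory
open Literature.RepresentationTheory.Liu2021 (OscillatorStandingData)
open Literature.RepresentationTheory.CentralCharacterQuotient (augmentation quotRep quotRep_mk)
open Literature.NumberTheory.GaloisRepresentations (HeckeCharacter)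

namespace Literature.NumberTheory.Automorphic.Liu2021.LemD1IndexedNonVacuityEpsAlone

open UnitaryGroup

/-! ## §1 Line carriers: the bookkeeping lemmas (copies of the siblings' private lemmas) -/

/-- `v_w(k) ≤ 1` for a natural number `k` (non-archimedean triangle inequality). [folklore] -/
private theorem valued_natCast_le_one {E : Type} [Field E] [NumberField E] (w : HeightOneSpectrum (𝓞 E)) (k : ℕ) :
    Valued.v ((k : w.adicCompletion E)) ≤ 1 := by
  induction k with
  | zero => simp
  | succ k ih =>
    rw [Nat.cast_succ]
    exact Valuation.map_add_le _ ih (by rw [Valuation.map_one])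

/-- For a datum whose carrier is the line `ℂ` with `U(V)(F)` acting through a character `λ` that agrees with `χ` on the centre,
the `χ`-augmentation submodule vanishes (copy of the siblings' private lemma). [folklore] -/
private theorem augmentation_eq_bot_of_character {F₀ E₀ : Type} [Field F₀] [ValuativeRel F₀] [TopologicalSpace F₀]
    [CommRing E₀] [Algebra F₀ E₀] [TopologicalSpace E₀] {n : ℕ} (L : LemD1Data F₀ E₀ n ℂ) (lam : L.S.U →* ℂˣ)
    (hω : ∀ (g : L.S.U) (x : ℂ), L.omega g x = (lam g : ℂ) * x)
    (hcen : ∀ z : L.S.normOne, lam (L.S.scalar z) = L.chi z) :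
    augmentation L.omega L.S.scalar L.chi = ⊥ := by
  unfold augmentation
  refine iSup_eq_bot.2 fun z => ?_
  rw [LinearMap.range_eq_bot]
  ext
  simp [hω, hcen]

/-- Two lines on which a group acts through characters `λ₁` and `λ₀` with `λ₁ g₀ ≠ λ₀ g₀` for some `g₀` have NON-isomorphic maximal
`χ`-quotients (the first quotient being the line itself).  Copy of the siblings' private lemma. [folklore] -/
private theorem not_areIsomorphicRep_quotRep_of_characters {G Z : Type*} [Group G] [Group Z]
    (ρ₁ ρ₀ : Representation ℂ G ℂ) {ζ : Z →* G} (hζ : ∀ z, ζ z ∈ Subgroup.center G) (χ₁ χ₀ : Z →* ℂˣ)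
    (lam₁ lam₀ : G →* ℂˣ) (h₁ : ∀ (g : G) (x : ℂ), ρ₁ g x = (lam₁ g : ℂ) * x) (h₀ : ∀ (g : G) (x : ℂ), ρ₀ g x = (lam₀ g : ℂ) * x)
    (hN₁ : augmentation ρ₁ ζ χ₁ = ⊥) {g₀ : G} (hg₀ : lam₁ g₀ ≠ lam₀ g₀) :
    ¬ AreIsomorphicRep (quotRep ρ₁ hζ χ₁) (quotRep ρ₀ hζ χ₀) := by
  rintro ⟨f, hf⟩
  have hw0 : (Submodule.Quotient.mk 1 : ℂ ⧸ augmentation ρ₁ ζ χ₁) ≠ 0 := by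
    rw [Ne, Submodule.Quotient.mk_eq_zero, hN₁, Submodule.mem_bot]
    exact one_ne_zero
  have h1 : quotRep ρ₁ hζ χ₁ g₀ (Submodule.Quotient.mk 1) =
      (lam₁ g₀ : ℂ) • (Submodule.Quotient.mk 1 : ℂ ⧸ augmentation ρ₁ ζ χ₁) := by
    rw [quotRep_mk, h₁, ← smul_eq_mul, Submodule.Quotient.mk_smul]
  have h2 : ∀ y : ℂ ⧸ augmentation ρ₀ ζ χ₀, quotRep ρ₀ hζ χ₀ g₀ y = (lam₀ g₀ : ℂ) • y := by
    intro y
    obtain ⟨u, rfl⟩ := Submodule.Quotient.mk_surjective _ y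
    rw [quotRep_mk, h₀, ← smul_eq_mul, Submodule.Quotient.mk_smul]
  have key := hf g₀ (Submodule.Quotient.mk 1)
  rw [h1, h2, map_smul] at key
  have hsub : ((lam₁ g₀ : ℂ) - lam₀ g₀) • f (Submodule.Quotient.mk 1) = 0 := by
    rw [sub_smul, key, sub_self]
  rcases smul_eq_zero.1 hsub with h | h
  · exact hg₀ (Units.ext (sub_eq_zero.1 h))
  · exact hw0 (f.injective (by rw [h, map_zero]))

/-- **Item (1) AS PRINTED holds at a character datum of rank `n ≠ 2`** (copy of the siblings' private lemma).
[cite: Liu2021, App. D Lemma D.1 (1) (l. 5229)] -/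
private theorem lemD1_1AsPrinted_of_character_of_rank_ne_two' {F₀ E₀ : Type} [Field F₀] [ValuativeRel F₀]
    [TopologicalSpace F₀] [CommRing E₀] [Algebra F₀ E₀] [TopologicalSpace E₀] [IsTopologicalRing E₀] {n₀ : ℕ}
    (L : LemD1Data F₀ E₀ n₀ ℂ) (lam : L.S.U →* ℂˣ) (hω : ∀ (g : L.S.U) (x : ℂ), L.omega g x = (lam g : ℂ) * x)
    (hcen : ∀ z : L.S.normOne, lam (L.S.scalar z) = L.chi z)
    (hopen : ∃ O : Set L.S.U, IsOpen O ∧ (1 : L.S.U) ∈ O ∧ ∀ g ∈ O, lam g = 1) (hn : n₀ ≠ 2) :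
    LemD1_1AsPrinted L := by
  have hN : augmentation L.omega L.S.scalar L.chi = ⊥ := augmentation_eq_bot_of_character L lam hω hcen
  have hfin : Module.finrank ℂ (ℂ ⧸ augmentation L.omega L.S.scalar L.chi) = 1 := by
    rw [(Submodule.quotEquivOfEqBot _ hN).finrank_eq, Module.finrank_self]
  haveI hsimple : IsSimpleModule ℂ (ℂ ⧸ augmentation L.omega L.S.scalar L.chi) :=
    isSimpleModule_iff_finrank_eq_one.2 hfin
  have hact : ∀ (g : L.S.U) (w : ℂ ⧸ augmentation L.omega L.S.scalar L.chi),
      L.datum.quot g w = (lam g : ℂ) • w := by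
    intro g w
    obtain ⟨y, rfl⟩ := Submodule.Quotient.mk_surjective _ w
    rw [LemD1Data.datum_quot, quotRep_mk, hω, ← smul_eq_mul, Submodule.Quotient.mk_smul]
  refine ⟨⟨?_, ?_, ?_⟩, ?_⟩
  · intro W
    rcases eq_bot_or_eq_top W.toSubmodule with h | h
    · exact Or.inl (Subrepresentation.toSubmodule_injective h)
    · exact Or.inr (Subrepresentation.toSubmodule_injective h)
  · intro x
    obtain ⟨O, hO, h1O, hlam⟩ := hopen
    change IsOpen (L.datum.quot.stabilizerSubgroup x : Set L.S.U)
    refine Subgroup.isOpen_of_mem_nhds _ (g := 1) (Filter.mem_of_superset (hO.mem_nhds h1O) fun g hg => ?_)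
    change L.datum.quot g x = x
    rw [hact, hlam g hg, Units.val_one, one_smul]
  · intro K _
    infer_instance
  · refine iff_of_false ?_ ?_
    · rw [not_subsingleton_iff_nontrivial]
      exact Module.nontrivial_of_finrank_pos (R := ℂ) (by rw [hfin]; exact one_pos)
    · exact fun h => hn h.2.1.2


/-- symmetry of «same class in `E^{−×}/Nm E^×`» (copy of the tree's `LemD1.SameClass.symm`, kept import-light). [cite: Liu2021, App. D §D.1 Step 1 (l. 5217)] -/
private theorem sameClass_symm {F₀ E₀ : Type} [Field F₀] [CommRing E₀] [Algebra F₀ E₀] {n : ℕ} {S : OscillatorStandingData F₀ E₀ n}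
    {e e' : LemD1.EpsRep S} (h : LemD1.SameClass e e') : LemD1.SameClass e' e := by
  obtain ⟨x, hx⟩ := h
  exact ⟨x⁻¹, by rw [map_inv, hx, ← mul_inv, inv_mul_cancel_left]⟩

/-! ## §2 The JOINT certificate «(1) ∧ (3)» with the `ε`-conjunct ALONE separating — non-split places carrying a centre-trivial character -/

section PlaceModel

variable {F : Type} (E : Type) [Field F] [NumberField F] [Field E] [NumberField E] [Algebra F E]
  [Algebra.IsQuadraticExtension F E] (v : HeightOneSpectrum (𝓞 F)) (c : E ≃ₐ[F] E)
  {δ : E} (hcδ : c δ = -δ) (hδ : δ ≠ 0)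
  (N : ℕ) (J : Matrix (Fin N) (Fin N) E) (hN : 2 ≤ N) (hJh : (J.map c)ᵀ = J) (hJdet : J.det ≠ 0)

/-- **the `ε`-alone family from ANY centre-trivial character `Ψ` of `U(V)(F_v)` with an open kernel neighbourhood and a non-trivial value, and
two INEQUIVALENT representatives `e ≁ e'`**: labels `(μ, e, 1)`, `(μ, e', 1)` — SAME `μ`, SAME `χ = 1` —, carriers the trivial line and the line
of `Ψ`; (1) member by member, (3) for all four pairs, exactly the `ε`-conjunct failing, the `ω`'s non-isomorphic with equal central characters.
[cite: Liu2021, App. D Lemma D.1 (1) and (3) (l. 5229, 5233)] -/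
private theorem exists_family_eps_of_central_trivial_character (h3 : 3 ≤ N)
    (μ : LemD1.MuSet (LemD1OfPlace.standingData E v c N J hcδ hδ hN hJh hJdet))
    (e e' : LemD1.EpsRep (LemD1OfPlace.standingData E v c N J hcδ hδ hN hJh hJdet)) (hee' : ¬ LemD1.SameClass e e')
    (Ψ : (LemD1OfPlace.standingData E v c N J hcδ hδ hN hJh hJdet).U →* ℂˣ)
    (hcen : ∀ z : (LemD1OfPlace.standingData E v c N J hcδ hδ hN hJh hJdet).normOne,
      Ψ ((LemD1OfPlace.standingData E v c N J hcδ hδ hN hJh hJdet).scalar z) = 1)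
    (hopen : ∃ O : Set (LemD1OfPlace.standingData E v c N J hcδ hδ hN hJh hJdet).U, IsOpen O ∧ 1 ∈ O ∧ ∀ g ∈ O, Ψ g = 1)
    (hne : ∃ g₀ : (LemD1OfPlace.standingData E v c N J hcδ hδ hN hJh hJdet).U, Ψ g₀ ≠ 1) :
    ∃ Lf : LemD1IndexedFamily (v.adicCompletion F) (LocalRing E v) N (Fin 2),
      Lf.S = LemD1OfPlace.standingData E v c N J hcδ hδ hN hJh hJdet ∧
      (Lf.eps 0).1 = e.1 ∧ (Lf.eps 1).1 = e'.1 ∧ (∀ i, (Lf.mu i).1 = μ.1) ∧ (∀ i, (Lf.chi i).1 = 1) ∧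
      Lf.Item1AsPrinted ∧ LemD1_3AsPrintedI Lf ∧
      Lf.mu 0 = Lf.mu 1 ∧ ¬ LemD1.SameClass (Lf.eps 0) (Lf.eps 1) ∧ Lf.chi 0 = Lf.chi 1 ∧
      ¬ AreIsomorphicRep (Lf.quot 1) (Lf.quot 0) := by
  classical
  have hN2 : N ≠ 2 := by omega
  obtain ⟨g₀, hΨg₀⟩ := hne
  let S := LemD1OfPlace.standingData E v c N J hcδ hδ hN hJh hJdet
  let χ₀ : LemD1.ChiSet S := ⟨1, fun z => by simp, by simpa using continuous_const⟩
  let ω₀ : Representation ℂ S.U ℂ := Representation.trivial ℂ S.U ℂ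
  let ω₁ : Representation ℂ S.U ℂ := (DistribMulAction.toModuleEnd ℂ ℂ).comp Ψ
  have hω₀ : ∀ (g : S.U) (x : ℂ), ω₀ g x = ((1 : S.U →* ℂˣ) g : ℂ) * x := fun g x => by
    rw [MonoidHom.one_apply, Units.val_one, one_mul]; rfl
  have hω₁ : ∀ (g : S.U) (x : ℂ), ω₁ g x = (Ψ g : ℂ) * x := fun g x => by
    change (Ψ g : ℂˣ) • x = _
    rw [Units.smul_def, smul_eq_mul]
  have hcen' : ∀ z : S.normOne, Ψ (S.scalar z) = χ₀.1 z := fun z => by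
    rw [hcen z]; rfl
  let Lf : LemD1IndexedFamily (v.adicCompletion F) (LocalRing E v) N (Fin 2) :=
    { isNonarchimedeanLocalField := inferInstance
      isModuleTopology := LemD1OfPlace.isModuleTopology_localRing E v
      S := S
      mu := fun _ => μ
      eps := ![e, e']
      chi := fun _ => χ₀
      V := fun _ => ℂ
      omega := ![ω₀, ω₁] }
  have hεne : ¬ LemD1.SameClass (Lf.eps 0) (Lf.eps 1) := hee'
  have hεne' : ¬ LemD1.SameClass (Lf.eps 1) (Lf.eps 0) := fun h => hee' (sameClass_symm h)
  have hN₁ : augmentation (Lf.single 1).omega (Lf.single 1).S.scalar (Lf.single 1).chi = ⊥ :=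
    augmentation_eq_bot_of_character (Lf.single 1) Ψ hω₁ hcen'
  have hg₀ : Ψ g₀ ≠ (1 : S.U →* ℂˣ) g₀ := by rwa [MonoidHom.one_apply]
  have hnotiso : ¬ AreIsomorphicRep (Lf.quot 1) (Lf.quot 0) :=
    not_areIsomorphicRep_quotRep_of_characters ω₁ ω₀ S.scalar_mem_center χ₀.1 χ₀.1 Ψ 1 hω₁ hω₀ hN₁ hg₀
  have hItem1 : Lf.Item1AsPrinted := by
    intro i
    fin_cases i
    · exact lemD1_1AsPrinted_of_character_of_rank_ne_two' (Lf.single 0) 1 hω₀ (fun z => rfl)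
        ⟨Set.univ, isOpen_univ, Set.mem_univ _, fun g _ => rfl⟩ hN2
    · exact lemD1_1AsPrinted_of_character_of_rank_ne_two' (Lf.single 1) Ψ hω₁ hcen' hopen hN2
  have hrefl : ∀ k : Fin 2, (AreIsomorphicRep (Lf.quot k) (Lf.quot k) ↔
      (Lf.mu k = Lf.mu k ∧ LemD1.SameClass (Lf.eps k) (Lf.eps k) ∧ Lf.chi k = Lf.chi k)) :=
    fun k => iff_of_true ⟨LinearEquiv.refl ℂ _, fun _ _ => rfl⟩ ⟨rfl, ⟨1, by simp⟩, rfl⟩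
  have hItem3 : LemD1_3AsPrintedI Lf := by
    intro _ i j
    fin_cases i <;> fin_cases j
    · exact hrefl 0
    · exact iff_of_false hnotiso fun h => hεne h.2.1
    · exact iff_of_false (fun h => hnotiso h.symm) fun h => hεne' h.2.1
    · exact hrefl 1
  exact ⟨Lf, rfl, rfl, rfl, fun _ => rfl, fun _ => rfl, hItem1, hItem3, rfl, hεne, rfl, hnotiso⟩

include hcδ in
/-- **(1) ∧ (3) JOINTLY with the `ε`-CONJUNCT ALONE SEPARATING — every NON-SPLIT place `w ∣ v` ABOVE A PRIME DIVIDING `N`, every `N ≥ 3`,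
ANY quadratic `E/F`**: for every `μ ∈ MuSet S` and every representative `e` there is an INEQUIVALENT representative `e'` (two `ε`-classes at a
non-split place, `…NonsplitPlace.exists_epsRep_not_sameClass_of_nonsplit`) and the two-member collection with labels `(μ, e, 1)`, `(μ, e', 1)`
and carriers the trivial line and the line of the wild carrier `Ψ` of `…WildCarrier` satisfies [Lem. D.1, first sentence + (1)] AS PRINTED member
by member AND [Lem. D.1 (3)] AS PRINTED for all four pairs; exactly the `ε`-conjunct fails; the `ω`'s are non-isomorphic with EQUAL central
characters.  (At a SPLIT place this cannot happen: there all representatives are equivalent, `…NonsplitPlace.sameClass_of_split`.)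
[cite: Liu2021, App. D Lemma D.1 (1) and (3) (l. 5229, 5233)] -/
theorem exists_lemD1IndexedFamily_item1_and_lemD1_3_eps_of_wild (w : PlacesOver E v) (hw : c • w.1 = w.1)
    (hwN : Valued.v ((N : w.1.adicCompletion E)) < 1) (h3 : 3 ≤ N)
    (μ : LemD1.MuSet (LemD1OfPlace.standingData E v c N J hcδ hδ hN hJh hJdet))
    (e : LemD1.EpsRep (LemD1OfPlace.standingData E v c N J hcδ hδ hN hJh hJdet)) :
    ∃ Lf : LemD1IndexedFamily (v.adicCompletion F) (LocalRing E v) N (Fin 2),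
      Lf.S = LemD1OfPlace.standingData E v c N J hcδ hδ hN hJh hJdet ∧
      (Lf.eps 0).1 = e.1 ∧ (∀ i, (Lf.mu i).1 = μ.1) ∧ (∀ i, (Lf.chi i).1 = 1) ∧
      Lf.Item1AsPrinted ∧ LemD1_3AsPrintedI Lf ∧
      Lf.mu 0 = Lf.mu 1 ∧ ¬ LemD1.SameClass (Lf.eps 0) (Lf.eps 1) ∧ Lf.chi 0 = Lf.chi 1 ∧
      ¬ AreIsomorphicRep (Lf.quot 1) (Lf.quot 0) := by
  obtain ⟨e', hee'⟩ := LemD1IndexedNonVacuityNonsplitPlace.exists_epsRep_not_sameClass_of_nonsplit E v c hcδ hδ N J hN hJh hJdet w hw e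
  obtain ⟨Ψ, hcen, hopen, hne, -, -⟩ := LemD1IndexedNonVacuityWildCarrier.exists_wild_carrier_character E v c hcδ hδ N J hN hJh hJdet w hw hwN
  obtain ⟨Lf, hS, h0, -, hμ, hχ, h1, h3', hμeq, hε, hχeq, hnot⟩ :=
    exists_family_eps_of_central_trivial_character E v c hcδ hδ N J hN hJh hJdet h3 μ e e' hee' Ψ hcen hopen hne
  exact ⟨Lf, hS, h0, hμ, hχ, h1, h3', hμeq, hε, hχeq, hnot⟩

include hcδ in
/-- **… and every NON-SPLIT place `w ∣ v` with `v_w(ζ − 1) = 1` for a norm-one `N`-torsion element `ζ ∈ E`** (`ζ · c(ζ) = 1`, `ζ^N = 1`), the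
carrier being the torsion carrier of `…TorsionCarrier`. [cite: Liu2021, App. D Lemma D.1 (1) and (3) (l. 5229, 5233)] -/
theorem exists_lemD1IndexedFamily_item1_and_lemD1_3_eps_of_torsion (w : PlacesOver E v) (hw : c • w.1 = w.1) (ζ : E)
    (hζc : ζ * c ζ = 1) (hζN : ζ ^ N = 1) (hζw : w.1.valuation E (ζ - 1) = 1) (h3 : 3 ≤ N)
    (μ : LemD1.MuSet (LemD1OfPlace.standingData E v c N J hcδ hδ hN hJh hJdet))
    (e : LemD1.EpsRep (LemD1OfPlace.standingData E v c N J hcδ hδ hN hJh hJdet)) :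
    ∃ Lf : LemD1IndexedFamily (v.adicCompletion F) (LocalRing E v) N (Fin 2),
      Lf.S = LemD1OfPlace.standingData E v c N J hcδ hδ hN hJh hJdet ∧
      (Lf.eps 0).1 = e.1 ∧ (∀ i, (Lf.mu i).1 = μ.1) ∧ (∀ i, (Lf.chi i).1 = 1) ∧
      Lf.Item1AsPrinted ∧ LemD1_3AsPrintedI Lf ∧
      Lf.mu 0 = Lf.mu 1 ∧ ¬ LemD1.SameClass (Lf.eps 0) (Lf.eps 1) ∧ Lf.chi 0 = Lf.chi 1 ∧
      ¬ AreIsomorphicRep (Lf.quot 1) (Lf.quot 0) := by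
  obtain ⟨e', hee'⟩ := LemD1IndexedNonVacuityNonsplitPlace.exists_epsRep_not_sameClass_of_nonsplit E v c hcδ hδ N J hN hJh hJdet w hw e
  obtain ⟨Ψ, hcen, hopen, hne, -, -⟩ :=
    LemD1IndexedNonVacuityTorsionCarrier.exists_torsion_carrier_character E v c hcδ hδ N J hN hJh hJdet w hw ζ hζc hζN hζw
  obtain ⟨Lf, hS, h0, -, hμ, hχ, h1, h3', hμeq, hε, hχeq, hnot⟩ :=
    exists_family_eps_of_central_trivial_character E v c hcδ hδ N J hN hJh hJdet h3 μ e e' hee' Ψ hcen hopen hne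
  exact ⟨Lf, hS, h0, hμ, hχ, h1, h3', hμeq, hε, hχeq, hnot⟩

include hcδ in
/-- **Consequence — every NON-SPLIT place above a prime dividing `N`, every `N ≥ 3`, ANY `E/F`, NO hypothesis on `μ`**: the records (1) ∧ (3)
read on an indexed collection over the place model do NOT by their shape force «same `μ` ∧ same `χ` ⟹ same `ε`-class»: in [Lem. D.1 (3)]
the `ε`-conjunct is independent of the other two there. [cite: Liu2021, App. D Lemma D.1 (1) and (3) (l. 5229, 5233)] -/
theorem not_forall_sameClass_of_mu_eq_of_chi_eq_of_wild (w : PlacesOver E v) (hw : c • w.1 = w.1)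
    (hwN : Valued.v ((N : w.1.adicCompletion E)) < 1) (h3 : 3 ≤ N) :
    ¬ ∀ Lf : LemD1IndexedFamily (v.adicCompletion F) (LocalRing E v) N (Fin 2),
        Lf.S = LemD1OfPlace.standingData E v c N J hcδ hδ hN hJh hJdet →
        Lf.Item1AsPrinted → LemD1_3AsPrintedI Lf →
        ∀ i j : Fin 2, Lf.mu i = Lf.mu j → Lf.chi i = Lf.chi j → LemD1.SameClass (Lf.eps i) (Lf.eps j) := by
  obtain ⟨μ⟩ := LemD1IndexedNonVacuityNormClassExtensionDyadic.nonempty_muSet E v c hcδ hδ N J hN hJh hJdet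
  intro h
  obtain ⟨Lf, hS, -, -, -, h1, h3', hμ, hε, hχ, -⟩ :=
    exists_lemD1IndexedFamily_item1_and_lemD1_3_eps_of_wild E v c hcδ hδ N J hN hJh hJdet w hw hwN h3 μ
      (LemD1OfPlace.epsDelta E v c N J hcδ hδ hN hJh hJdet)
  exact hε (h Lf hS h1 h3' 0 1 hμ hχ)

include hcδ in
/-- **Consequence — every NON-SPLIT place with `v_w(ζ − 1) = 1` for a norm-one `N`-torsion `ζ ∈ E`, every `N ≥ 3`, NO hypothesis on `μ`.**
[cite: Liu2021, App. D Lemma D.1 (1) and (3) (l. 5229, 5233)] -/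
theorem not_forall_sameClass_of_mu_eq_of_chi_eq_of_torsion (w : PlacesOver E v) (hw : c • w.1 = w.1) (ζ : E)
    (hζc : ζ * c ζ = 1) (hζN : ζ ^ N = 1) (hζw : w.1.valuation E (ζ - 1) = 1) (h3 : 3 ≤ N) :
    ¬ ∀ Lf : LemD1IndexedFamily (v.adicCompletion F) (LocalRing E v) N (Fin 2),
        Lf.S = LemD1OfPlace.standingData E v c N J hcδ hδ hN hJh hJdet →
        Lf.Item1AsPrinted → LemD1_3AsPrintedI Lf →
        ∀ i j : Fin 2, Lf.mu i = Lf.mu j → Lf.chi i = Lf.chi j → LemD1.SameClass (Lf.eps i) (Lf.eps j) := by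
  obtain ⟨μ⟩ := LemD1IndexedNonVacuityNormClassExtensionDyadic.nonempty_muSet E v c hcδ hδ N J hN hJh hJdet
  intro h
  obtain ⟨Lf, hS, -, -, -, h1, h3', hμ, hε, hχ, -⟩ :=
    exists_lemD1IndexedFamily_item1_and_lemD1_3_eps_of_torsion E v c hcδ hδ N J hN hJh hJdet w hw ζ hζc hζN hζw h3 μ
      (LemD1OfPlace.epsDelta E v c N J hcδ hδ hN hJh hJdet)
  exact hε (h Lf hS h1 h3' 0 1 hμ hχ)

include hcδ in
/-- **The SPLIT half of the dichotomy** (for contrast; `…NonsplitPlace.sameClass_of_split`): at a split place EVERY collection over the place model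
has all its representatives in ONE class — the `ε`-conjunct of (3) is identically true there, whatever the records. [cite: Liu2021, App. D §D.1 Step 1 (l. 5217); Lemma D.1 (3) (l. 5233)] -/
theorem forall_sameClass_of_split (w : PlacesOver E v) (hw : c • w.1 ≠ w.1) {ι : Type}
    (Lf : LemD1IndexedFamily (v.adicCompletion F) (LocalRing E v) N ι)
    (hS : Lf.S = LemD1OfPlace.standingData E v c N J hcδ hδ hN hJh hJdet) (i j : ι) :
    LemD1.SameClass (Lf.eps i) (Lf.eps j) := by
  rcases Lf with ⟨_, _, S₀, mu₀, eps₀, chi₀, V₀, ω₀⟩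
  change S₀ = _ at hS
  subst hS
  exact LemD1IndexedNonVacuityNonsplitPlace.sameClass_of_split E v c hcδ hδ N J hN hJh hJdet w hw (eps₀ i) (eps₀ j)

end PlaceModel

/-! ## §3 The CM rows: the `ε`-alone certificates with the rows' OWN `μ_v` in both members -/

section CM

open Literature.NumberTheory.GelbartRogawski1991.UnitaryDualPair (imagUnit complexConj_imagUnit imagUnit_ne_zero)
open Literature.NumberTheory.GelbartRogawski1991.UnitaryDualPair.LocalSplitting (localMu norm_localMu continuous_localMu
  localMu_toLocalRing_eq_one_iff)
open Literature.NumberTheory.Automorphic.IdeleClassGroup (toHeckeCharacter isUnitary_toHeckeCharacter IsConjugateSymplectic)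
open Literature.RepresentationTheory.Liu2021 (isOscillatorChar_toHeckeCharacter_iff)

variable (L : Type) [Field L] [NumberField L] [IsCMField L]

local notation3 "cc" => (IsCMField.complexConj L)
local notation3 "L⁺" => (↥(maximalRealSubfield L))

variable (v : HeightOneSpectrum (𝓞 (maximalRealSubfield L))) (N : ℕ) (J : Matrix (Fin N) (Fin N) L) (hN : 2 ≤ N)
  (hJh : (J.map (IsCMField.complexConj L))ᵀ = J) (hJdet : J.det ≠ 0)

/-- **the `ε`-alone certificate with the rows' OWN `μ_v` in BOTH members — NON-SPLIT `w ∣ v` with `v_w(N) < 1` (ANY CM field), every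
`N ≥ 3`, every conjugate symplectic `ψ`**: labels `(μ_v, ε, 1)`, `(μ_v, ε', 1)` with `μ_v = localMu L (toHeckeCharacter L ψ) v` and `ε' ≁ ε`;
(1) ∧ (3) hold, only the `ε`-slots differ in class, the `ω`'s non-isomorphic. [cite: Liu2021, App. D Lemma D.1 (1) and (3) (l. 5229, 5233); Def. 4.11 (l. 2086)] -/
theorem exists_lemD1IndexedFamily_item1_and_lemD1_3_localMu_eps_of_wild (w : PlacesOver L v) (hw : cc • w.1 = w.1)
    (hwN : Valued.v ((N : w.1.adicCompletion L)) < 1) (h3 : 3 ≤ N)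
    (ψ : IdeleClassGroup L →ₜ* Circle) (hψ : IsConjugateSymplectic L ψ) :
    ∃ Lf : LemD1IndexedFamily (v.adicCompletion L⁺) (LocalRing L v) N (Fin 2),
      Lf.S = LemD1OfPlace.standingData L v cc N J (complexConj_imagUnit L) (imagUnit_ne_zero L) hN hJh hJdet ∧
      (Lf.eps 0).1 = (LemD1OfPlace.epsDelta L v cc N J (complexConj_imagUnit L) (imagUnit_ne_zero L) hN hJh hJdet).1 ∧
      (∀ i, (Lf.mu i).1 = localMu L (toHeckeCharacter L ψ) v) ∧ (∀ i, (Lf.chi i).1 = 1) ∧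
      Lf.Item1AsPrinted ∧ LemD1_3AsPrintedI Lf ∧
      Lf.mu 0 = Lf.mu 1 ∧ ¬ LemD1.SameClass (Lf.eps 0) (Lf.eps 1) ∧ Lf.chi 0 = Lf.chi 1 ∧
      ¬ AreIsomorphicRep (Lf.quot 1) (Lf.quot 0) :=
  exists_lemD1IndexedFamily_item1_and_lemD1_3_eps_of_wild L v cc (complexConj_imagUnit L) (imagUnit_ne_zero L) N J hN hJh hJdet
    w hw hwN h3
    (LemD1OfPlace.muOf L v cc N J (complexConj_imagUnit L) (imagUnit_ne_zero L) hN hJh hJdet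
      (localMu L (toHeckeCharacter L ψ) v)
      (fun x => norm_localMu L (toHeckeCharacter L ψ) v (isUnitary_toHeckeCharacter L ψ) x)
      (continuous_localMu L (toHeckeCharacter L ψ) v)
      (fun t => localMu_toLocalRing_eq_one_iff L (toHeckeCharacter L ψ) v
        ((isOscillatorChar_toHeckeCharacter_iff ψ).mpr hψ) t))
    (LemD1OfPlace.epsDelta L v cc N J (complexConj_imagUnit L) (imagUnit_ne_zero L) hN hJh hJdet)

/-- **the records `hD1''` ∕ `hD3` read at the rows' slot types do not force «same `μ` ∧ same `χ` ⟹ same `ε`-class»** — ANY CM field, every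
NON-SPLIT place `w ∣ v` with `v_w(N) < 1`, every `N ≥ 3`; for `3 ∣ N`: every non-split place above `3`.
[cite: Liu2021, App. D Lemma D.1 (1) and (3) (l. 5229, 5233)] -/
theorem not_forall_sameClass_of_mu_eq_of_chi_eq_of_isCMField_of_wild (w : PlacesOver L v) (hw : cc • w.1 = w.1)
    (hwN : Valued.v ((N : w.1.adicCompletion L)) < 1) (h3 : 3 ≤ N) :
    ¬ ∀ Lf : LemD1IndexedFamily (v.adicCompletion L⁺) (LocalRing L v) N (Fin 2),
        Lf.S = LemD1OfPlace.standingData L v cc N J (complexConj_imagUnit L) (imagUnit_ne_zero L) hN hJh hJdet →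
        Lf.Item1AsPrinted → LemD1_3AsPrintedI Lf →
        ∀ i j : Fin 2, Lf.mu i = Lf.mu j → Lf.chi i = Lf.chi j → LemD1.SameClass (Lf.eps i) (Lf.eps j) :=
  not_forall_sameClass_of_mu_eq_of_chi_eq_of_wild L v cc (complexConj_imagUnit L) (imagUnit_ne_zero L) N J hN hJh hJdet w hw hwN h3

/-- **… and at every NON-SPLIT place `w ∤ 3` of a CM field `L ∋ ζ_3` (`ζ² + ζ + 1 = 0`) when `3 ∣ N`** (the torsion carrier).
[cite: Liu2021, App. D Lemma D.1 (1) and (3) (l. 5229, 5233)] -/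
theorem not_forall_sameClass_of_mu_eq_of_chi_eq_of_isCMField_of_cubeRoot (w : PlacesOver L v) (hw : cc • w.1 = w.1) (ζ : L)
    (hζ : ζ ^ 2 + ζ + 1 = 0) (h3N : 3 ∣ N) (h3w : (3 : 𝓞 L) ∉ w.1.asIdeal) (h3 : 3 ≤ N) :
    ¬ ∀ Lf : LemD1IndexedFamily (v.adicCompletion L⁺) (LocalRing L v) N (Fin 2),
        Lf.S = LemD1OfPlace.standingData L v cc N J (complexConj_imagUnit L) (imagUnit_ne_zero L) hN hJh hJdet →
        Lf.Item1AsPrinted → LemD1_3AsPrintedI Lf →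
        ∀ i j : Fin 2, Lf.mu i = Lf.mu j → Lf.chi i = Lf.chi j → LemD1.SameClass (Lf.eps i) (Lf.eps j) := by
  have hζ3 : ζ ^ 3 = 1 := by linear_combination (ζ - 1) * hζ
  obtain ⟨k, rfl⟩ := h3N
  have hζN : ζ ^ (3 * k) = 1 := by rw [pow_mul, hζ3, one_pow]
  have hζc : ζ * cc ζ = 1 := by
    let φ : L →+* ℂ := Classical.choice (inferInstance : Nonempty (L →+* ℂ))
    apply φ.injective
    have h1 : ‖φ ζ‖ = 1 := Complex.norm_eq_one_of_pow_eq_one (by rw [← map_pow, hζ3, map_one]) (by norm_num)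
    rw [map_mul, IsCMField.complexEmbedding_complexConj, map_one, Complex.mul_conj, Complex.normSq_eq_norm_sq, h1, one_pow,
      Complex.ofReal_one]
  exact not_forall_sameClass_of_mu_eq_of_chi_eq_of_torsion L v cc (complexConj_imagUnit L) (imagUnit_ne_zero L) (3 * k) J hN hJh hJdet
    w hw ζ hζc hζN (LemD1IndexedNonVacuityTorsionCarrier.valuation_sub_one_eq_one_of_cubeRoot w.1 ζ hζ h3w) h3

/-- **EVERY NON-SPLIT place `v` of `L⁺`** — `L` a CM field containing `ζ_3`, `3 ∣ N`, `N ≥ 3`: at every finite place `v` of `L⁺` and every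
NON-SPLIT `w ∣ v` the records do not force «same `μ` ∧ same `χ` ⟹ same `ε`-class» (above `3`: wild; away from `3`: torsion).  At the SPLIT
places the `ε`-conjunct is identically true (`forall_sameClass_of_split`). [cite: Liu2021, App. D Lemma D.1 (1) and (3) (l. 5229, 5233)] -/
theorem forall_not_forall_sameClass_of_mu_eq_of_chi_eq_of_isCMField_of_cubeRoot (ζ : L) (hζ : ζ ^ 2 + ζ + 1 = 0) (h3N : 3 ∣ N)
    (h3 : 3 ≤ N) :
    ∀ (v : HeightOneSpectrum (𝓞 L⁺)) (w : PlacesOver L v), cc • w.1 = w.1 →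
      ¬ ∀ Lf : LemD1IndexedFamily (v.adicCompletion L⁺) (LocalRing L v) N (Fin 2),
          Lf.S = LemD1OfPlace.standingData L v cc N J (complexConj_imagUnit L) (imagUnit_ne_zero L) hN hJh hJdet →
          Lf.Item1AsPrinted → LemD1_3AsPrintedI Lf →
          ∀ i j : Fin 2, Lf.mu i = Lf.mu j → Lf.chi i = Lf.chi j → LemD1.SameClass (Lf.eps i) (Lf.eps j) := by
  intro v w hw
  by_cases h3w : (3 : 𝓞 L) ∈ w.1.asIdeal
  · obtain ⟨k, rfl⟩ := h3N
    have hwN : Valued.v (((3 * k : ℕ) : w.1.adicCompletion L)) < 1 := by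
      have h3v : Valued.v ((3 : ℕ) : w.1.adicCompletion L) < 1 := by
        rw [← map_natCast (algebraMap L (w.1.adicCompletion L)) 3]
        change Valued.v ((((3 : ℕ) : L)) : w.1.adicCompletion L) < 1
        rw [HeightOneSpectrum.valuedAdicCompletion_eq_valuation', Nat.cast_ofNat,
          show (3 : L) = algebraMap (𝓞 L) L 3 from (map_ofNat (algebraMap (𝓞 L) L) 3).symm,
          HeightOneSpectrum.valuation_lt_one_iff_mem]
        exact h3w
      have hk : Valued.v ((k : w.1.adicCompletion L)) ≤ 1 := valued_natCast_le_one w.1 k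
      rw [Nat.cast_mul, Valuation.map_mul, mul_comm]
      exact mul_lt_of_le_one_of_lt hk h3v
    exact not_forall_sameClass_of_mu_eq_of_chi_eq_of_isCMField_of_wild L v (3 * k) J hN hJh hJdet w hw hwN h3
  · exact not_forall_sameClass_of_mu_eq_of_chi_eq_of_isCMField_of_cubeRoot L v N J hN hJh hJdet w hw ζ hζ h3N h3w h3

end CM

end Literature.NumberTheory.Automorphic.Liu2021.LemD1IndexedNonVacuityEpsAlone

end
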